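import Literature.MathematicalPhysics.QuantumFieldTheory.Balaban1983to89.Node00.CarriersY
import Literature.MathematicalPhysics.QuantumFieldTheory.Balaban1983to89.B9Thm39Whole
import Literature.MathematicalPhysics.QuantumFieldTheory.Balaban1983to89.B9Eq3132Whole
import Literature.MathematicalPhysics.QuantumFieldTheory.Balaban1983to89.B9GeoNormsKLevelV1

/-!
# BalabanUVNodes ∕ N06 ([B9], `Dag.B9_main`) — OBLIGATIONS OF THE STAGE-11 CERTIFICATE KNIT AT THE RECORD, XI-b:
# rows 15 (`t39`), 16 (`hksum`), 26 (`s3132`) AS LEMMAS AT THE RECORD, from the suppliers' pins ∕ inputs (n06-j, n06-i)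

Track A of `YM-PLAN.md` (cell `pub-ymgap`, HUMAN RULING D-0062), node **N06** = [Balaban1985BackgroundPropagators] Thms 3.1–3.15; seat
`pub-ymgap-dag-n06-d` gen 2 = dag-lead N06-ASSIGNMENT v1 (P3) «THE KNIT AT THE RECORD».  Companion of `BalabanUVNodesN06AtRecord11ObligationsPins`: the per-row lemmas
of rows 15, 16, 26 (consumed INLINE by the chain link `BalabanUVNodesN06AtRecord11ObligationsBatch2`; stated here BY NAME so that the final instantiation at def-Y's
`Node00.opsYOfLetters` can take them row by row).  Each concludes the certificate binder's type VERBATIM at `ops : OpsY N θ₃ M⋆`.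

ROWS AND SUPPLIERS (consumed BY NAME at `I := MemberY`, `geo9Y`, `bg9Y (M_N ℂ) SU(N)`, `c35Y`; every schema displayed, nothing of [B9] asserted):
* row 15 `t39_of_pin` — n06-j's `B9Thm39Whole.thm39Printed_of_local348` (p462736) at the LITERAL pin `(ops x).EK39 = EK39OfOps (𝔬39 x) (rd39 x) (d₆+1) B₁′ δ₁′`.
* row 16 `hksum_of_pin` — n06-j's `B9Thm39Whole.rwKernelSumYields_of_conv348` at the same pin with the kernel reading `KerReads` of `(ops x).Cinv`.
* row 26 `s3132_of_inputs` — n06-i's `B9Eq3132Whole.stmt3132Printed_of_coercive` (p462308); its four carrier facts (symmetric ∕ reflexive ∕ triangle (2.46)-distance, `Lʲη ≥ 0`)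
  DISCHARGED on the record's k-level tori (`SimpleGraph.dist_comm`, `B9GeoNormsKLevelV1.distT_self`, `B6Geom246MultiLevelTorus.triangle_refl_nonneg_T`, `len_pos`).

HONEST FRAMING.  Kernel bookkeeping at pinned readings; 0 `def`, 0 `sorry`, standard axioms; COUNT-NEUTRAL (`--supports` K1 `StabilityBAtRecordR11e`); nothing of [B9] is
proved for Bałaban's operators; N06 is NOT discharged.  One finite four-torus programme at fixed `ε` — NOT ℝ⁴, NOT OS, NOT a mass gap, NOT Clay.  No `def`.
-/

noncomputable section

namespace Summit.QuantumFields.YangMills.BalabanUVNodes.N06AtRecord11ObligationsPins2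

open Literature.MathematicalPhysics.QuantumFieldTheory.Balaban1983to89
open Literature.MathematicalPhysics.QuantumFieldTheory.Balaban1983to89.Node00
open Literature.MathematicalPhysics.QuantumFieldTheory.Balaban1983to89.B9PinMembersKLevelV1 (MemberY geo9Y bg9Y)
open Literature.MathematicalPhysics.QuantumFieldTheory.Balaban1983to89.B9PinGeometryKLevelV1 (c35Y c35Y_pos)
open Literature.MathematicalPhysics.QuantumFieldTheory.Balaban1983to89.B7Prop2SpecialUnitary (specialUnitaryUnits)
open Literature.MathematicalPhysics.QuantumFieldTheory.Balaban1983to89.B6RandomWalk (Ineq261)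
open Literature.MathematicalPhysics.QuantumFieldTheory.Balaban1983to89.B9Thm34Ext (toB6)
open Literature.MathematicalPhysics.QuantumFieldTheory.Balaban1983to89.B6KLevelCensusIndexV1 (len_pos)
open Literature.MathematicalPhysics.QuantumFieldTheory.Balaban1983to89.B9GeoNormsKLevelV1 (distT_self)
open Literature.MathematicalPhysics.QuantumFieldTheory.Balaban1983to89.B6Ineq2142KLevelV1 (β)
open Literature.MathematicalPhysics.QuantumFieldTheory.Balaban1983to89.B9Thm39Whole
  (Ops39 WalkReading39 EK39OfOps StaticOK39 Local348 Identities395 Small285 Factors389 Locality39 KerReads thm39Printed_of_local348 rwKernelSumYields_of_conv348)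
open Literature.MathematicalPhysics.QuantumFieldTheory.Balaban1983to89.B9Eq3132Whole (CTInputs InvNormalised WeightsTransfer stmt3132Printed_of_coercive)
open scoped Matrix.Norms.L2Operator

variable {N : ℕ} (θ₃ : Stage3Params) (Mstar : ℕ) (ops : OpsY N θ₃ Mstar)

/-! ## rows 15–16 — Theorem 3.9 and the kernel summation at the literal pin of `EK39` -/

/-- **ROW 15 `t39` AT THE RECORD FROM n06-j's LEAF** at the LITERAL pin `(ops x).EK39 = EK39OfOps (𝔬39 x) (rd39 x) (d₆+1) (2(N B₀)c₁(d₆+1, r, α′)) ((1−α′)r)` (the leaf reads the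
walk data): from the schemas `StaticOK39`, `Locality39`, the two (2.61)'s for M ≧ M_L, «Cor. 3.6 ∕ (3.95) ∕ (2.85) ∕ (3.89) at U» under the provisos —
`B9.Thm39Printed (θ₃.d₆+1) c35Y geo9Y (bg9Y …) (fun x => (ops x).EK39)`, the certificate's binder verbatim; `0 < c35` by `c35Y_pos`.
[cite: Balaban1985BackgroundPropagators, Thm 3.9 (3.98)–(3.99) p.413, Cor. 3.6 p.408; Balaban1984PropagatorsII, Lemma 2.1 (2.61) p.234] -/
theorem t39_of_pin [∀ x : MemberY θ₃.d₆ θ₃.ℓ₆ θ₃.hd' θ₃.hL' θ₃.b₀ θ₃.b₁ Mstar, Fintype (geo9Y x).Site] [∀ x : MemberY θ₃.d₆ θ₃.ℓ₆ θ₃.hd' θ₃.hL' θ₃.b₀ θ₃.b₁ Mstar, DecidableEq (geo9Y x).Site]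
    {ι κ : MemberY θ₃.d₆ θ₃.ℓ₆ θ₃.hd' θ₃.hL' θ₃.b₀ θ₃.b₁ Mstar → Type} [∀ x, Fintype (ι x)]
    (𝔬39 : ∀ x : MemberY θ₃.d₆ θ₃.ℓ₆ θ₃.hd' θ₃.hL' θ₃.b₀ θ₃.b₁ Mstar, Ops39 (geo9Y x) (bg9Y (Matrix (Fin N) (Fin N) ℂ) (specialUnitaryUnits (Fin N)) x) (ι x) (κ x)) (rd39 : ∀ x : MemberY θ₃.d₆ θ₃.ℓ₆ θ₃.hd' θ₃.hL' θ₃.b₀ θ₃.b₁ Mstar, WalkReading39 (bg9Y (Matrix (Fin N) (Fin N) ℂ) (specialUnitaryUnits (Fin N)) x) (ι x) (κ x))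
    (R : MemberY θ₃.d₆ θ₃.ℓ₆ θ₃.hd' θ₃.hL' θ₃.b₀ θ₃.b₁ Mstar → ℝ) (H : MemberY θ₃.d₆ θ₃.ℓ₆ θ₃.hd' θ₃.hL' θ₃.b₀ θ₃.b₁ Mstar → Prop) (α α' r δ₀ θ₀ B₀ Nn a₁ M₁ ML : ℝ)
    (hα : 0 ≤ α) (hα1 : α < 1) (hα' : α' ≤ 1) (hr : 0 ≤ r) (hrδ : r ≤ δ₀) (hδ₀ : 0 < δ₀) (hθ₀ : 0 ≤ θ₀) (hB₀ : 0 < B₀) (hN : 0 ≤ Nn)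
    (ha₁ : 0 < a₁) (hM₁ : 0 < M₁)
    (hst : ∀ x, StaticOK39 (𝔬39 x) Nn) (hloc : ∀ x, Locality39 (𝔬39 x) (rd39 x))
    (h261 : ∀ x : MemberY θ₃.d₆ θ₃.ℓ₆ θ₃.hd' θ₃.hL' θ₃.b₀ θ₃.b₁ Mstar, ML ≤ (geo9Y x).M →
      Ineq261 (θ₃.d₆ + 1) (toB6 (geo9Y x) (R x) (H x)) δ₀ α ∧ Ineq261 (θ₃.d₆ + 1) (toB6 (geo9Y x) (R x) (H x)) r α')
    (h39 : ∀ x : MemberY θ₃.d₆ θ₃.ℓ₆ θ₃.hd' θ₃.hL' θ₃.b₀ θ₃.b₁ Mstar, M₁ ≤ (geo9Y x).M → ∀ α₀ : ℝ, 0 < α₀ → c35Y * (geo9Y x).M * α₀ ≤ a₁ →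
      ∀ U : (bg9Y (Matrix (Fin N) (Fin N) ℂ) (specialUnitaryUnits (Fin N)) x).Cfg, (bg9Y (Matrix (Fin N) (Fin N) ℂ) (specialUnitaryUnits (Fin N)) x).Reg335 c35Y α₀ U →
        Local348 (𝔬39 x) (θ₃.d₆ + 1) B₀ δ₀ U ∧ Identities395 (𝔬39 x) U ∧ Small285 (𝔬39 x) (θ₃.d₆ + 1) θ₀ r U ∧
          Factors389 (𝔬39 x) (θ₃.d₆ + 1) θ₀ δ₀ U)
    (hEK39 : ∀ x : MemberY θ₃.d₆ θ₃.ℓ₆ θ₃.hd' θ₃.hL' θ₃.b₀ θ₃.b₁ Mstar, (ops x).EK39 = EK39OfOps (𝔬39 x) (rd39 x) (θ₃.d₆ + 1) (2 * (Nn * B₀) * B6.c1 (θ₃.d₆ + 1) r α') ((1 - α') * r)) :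
    B9.Thm39Printed (θ₃.d₆ + 1) c35Y geo9Y (bg9Y (Matrix (Fin N) (Fin N) ℂ) (specialUnitaryUnits (Fin N))) (fun x => (ops x).EK39) := by
  have hfun : (fun x => (ops x).EK39) = fun x => EK39OfOps (𝔬39 x) (rd39 x) (θ₃.d₆ + 1) (2 * (Nn * B₀) * B6.c1 (θ₃.d₆ + 1) r α') ((1 - α') * r) :=
    funext hEK39
  rw [hfun]
  exact thm39Printed_of_local348 𝔬39 rd39 R H (θ₃.d₆ + 1) α α' r δ₀ θ₀ B₀ Nn a₁ M₁ ML c35Y_pos hα hα1 hα' hr hrδ hδ₀ hθ₀ hB₀ hN ha₁ hM₁ hst hloc h261 h39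

/-- **ROW 16 `hksum` AT THE RECORD FROM n06-j's LEAF** at the same literal pin: convergence of the pinned datum at `U` IS `Conv348 …` (`Iff.rfl`), and a carrier kernel READING the
inverse (`KerReads (𝔬39 x) (ops x).Cinv (d₆+1)`) turns it into the kernel bound (3.48) — `B9.RWKernelSumYields (θ₃.d₆+1) geo9Y (bg9Y …) (fun x => (ops x).EK39) (fun x => (ops x).Cinv)`,
the certificate's binder verbatim; the positivity side conditions of the pinned constants displayed. [cite: Balaban1985BackgroundPropagators, Thm 3.9 ⇒ Thm 3.2 p.413 + (3.48) p.398] -/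
theorem hksum_of_pin [∀ x : MemberY θ₃.d₆ θ₃.ℓ₆ θ₃.hd' θ₃.hL' θ₃.b₀ θ₃.b₁ Mstar, DecidableEq (geo9Y x).Site]
    {ι κ : MemberY θ₃.d₆ θ₃.ℓ₆ θ₃.hd' θ₃.hL' θ₃.b₀ θ₃.b₁ Mstar → Type} [∀ x, Fintype (ι x)]
    (𝔬39 : ∀ x : MemberY θ₃.d₆ θ₃.ℓ₆ θ₃.hd' θ₃.hL' θ₃.b₀ θ₃.b₁ Mstar, Ops39 (geo9Y x) (bg9Y (Matrix (Fin N) (Fin N) ℂ) (specialUnitaryUnits (Fin N)) x) (ι x) (κ x)) (rd39 : ∀ x : MemberY θ₃.d₆ θ₃.ℓ₆ θ₃.hd' θ₃.hL' θ₃.b₀ θ₃.b₁ Mstar, WalkReading39 (bg9Y (Matrix (Fin N) (Fin N) ℂ) (specialUnitaryUnits (Fin N)) x) (ι x) (κ x))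
    {r α' B₀ Nn : ℝ}
    (hEK39 : ∀ x : MemberY θ₃.d₆ θ₃.ℓ₆ θ₃.hd' θ₃.hL' θ₃.b₀ θ₃.b₁ Mstar, (ops x).EK39 = EK39OfOps (𝔬39 x) (rd39 x) (θ₃.d₆ + 1) (2 * (Nn * B₀) * B6.c1 (θ₃.d₆ + 1) r α') ((1 - α') * r))
    (hB₁ : 0 < 2 * (Nn * B₀) * B6.c1 (θ₃.d₆ + 1) r α') (hδ₁ : 0 < (1 - α') * r)
    (hrdC : ∀ x : MemberY θ₃.d₆ θ₃.ℓ₆ θ₃.hd' θ₃.hL' θ₃.b₀ θ₃.b₁ Mstar, KerReads (𝔬39 x) (ops x).Cinv (θ₃.d₆ + 1)) :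
    B9.RWKernelSumYields (θ₃.d₆ + 1) geo9Y (bg9Y (Matrix (Fin N) (Fin N) ℂ) (specialUnitaryUnits (Fin N))) (fun x => (ops x).EK39) (fun x => (ops x).Cinv) :=
  rwKernelSumYields_of_conv348 𝔬39 (fun x => (ops x).Cinv) (θ₃.d₆ + 1) hB₁ hδ₁ (fun x U h => by rw [hEK39 x] at h; exact h) hrdC

/-! ## row 26 — (3.132) from the Combes–Thomas inputs, carrier facts discharged -/

/-- **ROW 26 `s3132` AT THE RECORD FROM n06-i's LEAF**: Combes–Thomas inputs ×2, the normalisation readings `InvNormalised` of `(ops x).QGQinv` ∕ `(ops x).QG1Qinv`, `0 < A`, the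
weights transfer — `B9.Stmt3132Printed (θ₃.d₆+1) c35Y geo9Y (bg9Y …) (fun x => (ops x).QGQinv) (fun x => (ops x).QG1Qinv)`, the certificate's binder verbatim; the four
carrier facts (symmetry, reflexivity, (2.54), `Lʲη ≥ 0`) DISCHARGED on the k-level tori. [cite: Balaban1985BackgroundPropagators, (3.132) p.422; Balaban1984PropagatorsII, (2.46) p.231, (2.54) p.233] -/
theorem s3132_of_inputs [∀ x : MemberY θ₃.d₆ θ₃.ℓ₆ θ₃.hd' θ₃.hL' θ₃.b₀ θ₃.b₁ Mstar, Fintype (geo9Y x).Site] [∀ x : MemberY θ₃.d₆ θ₃.ℓ₆ θ₃.hd' θ₃.hL' θ₃.b₀ θ₃.b₁ Mstar, DecidableEq (geo9Y x).Site]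
    {S S₁ : ∀ x : MemberY θ₃.d₆ θ₃.ℓ₆ θ₃.hd' θ₃.hL' θ₃.b₀ θ₃.b₁ Mstar, (bg9Y (Matrix (Fin N) (Fin N) ℂ) (specialUnitaryUnits (Fin N)) x).Cfg → Matrix (geo9Y x).Site (geo9Y x).Site ℝ}
    {w w₁ : ∀ x : MemberY θ₃.d₆ θ₃.ℓ₆ θ₃.hd' θ₃.hL' θ₃.b₀ θ₃.b₁ Mstar, (geo9Y x).Site → ℝ}
    (hCT : CTInputs c35Y geo9Y (bg9Y (Matrix (Fin N) (Fin N) ℂ) (specialUnitaryUnits (Fin N))) S) (hCT₁ : CTInputs c35Y geo9Y (bg9Y (Matrix (Fin N) (Fin N) ℂ) (specialUnitaryUnits (Fin N))) S₁)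
    (hN : ∀ x : MemberY θ₃.d₆ θ₃.ℓ₆ θ₃.hd' θ₃.hL' θ₃.b₀ θ₃.b₁ Mstar, InvNormalised (ops x).QGQinv (S x) (w x)) (hN₁ : ∀ x : MemberY θ₃.d₆ θ₃.ℓ₆ θ₃.hd' θ₃.hL' θ₃.b₀ θ₃.b₁ Mstar, InvNormalised (ops x).QG1Qinv (S₁ x) (w₁ x))
    {A : ℝ} (hA : 0 < A)
    (hwt : ∀ ε : ℝ, 0 < ε → ∃ Mw : ℝ, ∀ x : MemberY θ₃.d₆ θ₃.ℓ₆ θ₃.hd' θ₃.hL' θ₃.b₀ θ₃.b₁ Mstar, Mw ≤ (geo9Y x).M →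
      WeightsTransfer (geo9Y x) (θ₃.d₆ + 1) (w x) ε A ∧ WeightsTransfer (geo9Y x) (θ₃.d₆ + 1) (w₁ x) ε A) :
    B9.Stmt3132Printed (θ₃.d₆ + 1) c35Y geo9Y (bg9Y (Matrix (Fin N) (Fin N) ℂ) (specialUnitaryUnits (Fin N))) (fun x => (ops x).QGQinv) (fun x => (ops x).QG1Qinv) := by
  have hMh : ∀ x : MemberY θ₃.d₆ θ₃.ℓ₆ θ₃.hd' θ₃.hL' θ₃.b₀ θ₃.b₁ Mstar, 1 ≤ x.Mh := fun x => le_trans (by norm_num) x.hM8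
  have hP : ∀ x : MemberY θ₃.d₆ θ₃.ℓ₆ θ₃.hd' θ₃.hL' θ₃.b₀ θ₃.b₁ Mstar, ∀ μ, 1 ≤ x.P' μ := fun x μ => le_trans (by norm_num) (x.hP5 μ)
  have hsymm : ∀ (x : MemberY θ₃.d₆ θ₃.ℓ₆ θ₃.hd' θ₃.hL' θ₃.b₀ θ₃.b₁ Mstar) (y y' : (geo9Y x).Site), (geo9Y x).dist y y' = (geo9Y x).dist y' y := fun x y y' => by
    show (((B6Geom246MultiLevelTorus.bondT x.D).dist (β x.hN x.D x.hk y) (β x.hN x.D x.hk y') : ℕ) : ℝ) = _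
    rw [SimpleGraph.dist_comm]; rfl
  have hzero : ∀ (x : MemberY θ₃.d₆ θ₃.ℓ₆ θ₃.hd' θ₃.hL' θ₃.b₀ θ₃.b₁ Mstar) (y : (geo9Y x).Site), (geo9Y x).dist y y = 0 := fun x y => distT_self x.toKIdx (β x.hN x.D x.hk y)
  have htri : ∀ (x : MemberY θ₃.d₆ θ₃.ℓ₆ θ₃.hd' θ₃.hL' θ₃.b₀ θ₃.b₁ Mstar) (a b c : (geo9Y x).Site), (geo9Y x).dist a c ≤ (geo9Y x).dist a b + (geo9Y x).dist b c :=
    fun x a b c => (B6Geom246MultiLevelTorus.triangle_refl_nonneg_T x.D (hMh x) (hP x)).1 (β x.hN x.D x.hk a) (β x.hN x.D x.hk b) (β x.hN x.D x.hk c)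
  have hlen : ∀ (x : MemberY θ₃.d₆ θ₃.ℓ₆ θ₃.hd' θ₃.hL' θ₃.b₀ θ₃.b₁ Mstar) (y : (geo9Y x).Site), 0 ≤ (geo9Y x).len y := fun x y => (len_pos x.toKIdx y).le
  exact stmt3132Printed_of_coercive (θ₃.d₆ + 1) hCT hCT₁ hN hN₁ hsymm hzero htri hlen hA hwt

end Summit.QuantumFields.YangMills.BalabanUVNodes.N06AtRecord11ObligationsPins2

end
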